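import Mathlib
import Summits.ResolutionOfSingularities.ResolutionOfSingularities.Theorems.WeightedInvariantLocalWeightedDropNCResSurfGraphTangent
import Summits.ResolutionOfSingularities.ResolutionOfSingularities.Theorems.WeightedInvariantLocalWeightedDropNCResCurveGraphStep

/-!
# `WeightedInvariant.LocalWeightedDrop`: NC-resolution settings for the TOT₂ line — GRAPH SURFACES, part 5: under the identity point move,
# A SAME-HEAD ANSWER LIES IN THE TANGENT PLANE of the permissible graph surface (apex dimension `≤ 2`)

Crux item stmt-ResolutionOfSingularities-8899 `LocalWeightedDrop` (route `ResolutionOfSingularities/WeightedInvariant`), ENGINE skeleton v32, residuals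
`stub_spaceNCRankDrop` / `stub_wildWideApexFourStartsWon` (res-L1-w43-strat-1's line `directrix-cut` v3.1, piece PL = `ApexPlaneExit`, SURFACE sub-case;
design memo `L/res-L1-w43-stub-4/g5/S-E2-SURF.md`).  [OURS · L1 W4.3 · chain w43 · seat res-L1-w43-stub-4 gen 5; def-free on parts 1–3 and on
res-L1-w43-stub-1's S-SET 16 (`GraphCurve.le_order_slice_of_head_eq`, `GraphCurve.order_f_eq_o`) and res-L1-w43-stub-3's S-NEAR
(`TOT2Near.near_old`, `TOT2Near.inv_mul_prod_X_iff`); the surface twin of `GraphCurve.tangent_answer_of_head_eq`; the count game is the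
programme's own; nothing here is a statement of any manuscript; AI-produced, gate-checked, weaker than expert review.]

* **`tangentPlane_answer_of_head_eq`** — from an admissibly decorated position with product `g = f·∏_O x_l` of order `c`, a permissible graph
  SURFACE `(a, b, ψ)` (`Φ_S^* g ∈ (x_j : j ∉ {a,b})^c`) and apex dimension `≤ 2` (every three invariance vectors of `in_c g` dependent): an
  answer `(c′, i′)` of the identity point move at which the head did NOT drop satisfies `c′ = c′_a • tangentL + c′_b • tangentR` with
  `(c′_a, c′_b) ≠ (0, 0)` — same head ⇒ `O`-near (S-SET 16) ⇒ `c′ ∈ Dir(in_c g)` ((N1) with history) ⇒ in the tangent plane (part 3's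
  `eq_combo_tangent_of_inv`).  So the successor is read at the live slot `a` (if `c′_a ≠ 0`) or `b`, and it lies on the strict transform of the
  surface (sequel: the point-move step).
* `answer_apply_of_eq_combo_tangent` — its coordinates: `c′_j = c′_a ∂₁ψ_j(0) + c′_b ∂₂ψ_j(0)` off the base.
* `linear_coeffs_eq_zero_of_answer_eq_zero` — a boundary letter that PASSES THROUGH such an answer (`c′_l = 0`, `l ∉ {a,b}`) has a trace whose
  linear part vanishes at `(c′_a, c′_b)`.
-/

set_option linter.dupNamespace false -- mandated namespace of this single-conjunct summit

noncomputable section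

namespace Summit.ResolutionOfSingularities.ResolutionOfSingularities.Theorems

namespace TameFourTupleDrop

namespace GraphSurf

open MvPowerSeries Literature.AlgebraicGeometry.Resolution

variable {k : Type} [Field k] {m : ℕ}

/-- **THE SAME-HEAD ANSWER LIES IN THE TANGENT PLANE** (OURS · L1 W4.3; S-E2-SURF).  From an admissibly decorated position with product
`g = f·∏_O x_l` of order `c`, a permissible graph surface `(a, b, ψ)` and apex dimension `≤ 2`: an answer `(c′, i′)` of the identity point move at
which the head did NOT drop satisfies `c′ = c′_a • tangentL + c′_b • tangentR` with `c′_a ≠ 0 ∨ c′_b ≠ 0`. -/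
theorem tangentPlane_answer_of_head_eq [Infinite k] {b₀ : MvPowerSeries (Fin (m + 1)) k} {δ : Decoration k m} (hadm : Admissible b₀ δ)
    {a b : Fin (m + 1)} (hab : a ≠ b) {ψ : Fin (m + 1) → MvPowerSeries (Fin 2) k}
    (hψ : ∀ j, ¬ (j = a ∨ j = b) → constantCoeff (ψ j) = 0)
    (hperm : InOffPlaneIdeal a b δ.c (subst (shear a b ψ) (δ.f * ∏ l ∈ δ.O, X l)))
    (htwo : ∀ u₁ u₂ u₃ : Fin (m + 1) → k,
      (∀ v, CobordantChart.initEval (fun _ : Fin (m + 1) => 1) (v + u₁) δ.c (δ.f * ∏ l ∈ δ.O, X l) =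
        CobordantChart.initEval (fun _ : Fin (m + 1) => 1) v δ.c (δ.f * ∏ l ∈ δ.O, X l)) →
      (∀ v, CobordantChart.initEval (fun _ : Fin (m + 1) => 1) (v + u₂) δ.c (δ.f * ∏ l ∈ δ.O, X l) =
        CobordantChart.initEval (fun _ : Fin (m + 1) => 1) v δ.c (δ.f * ∏ l ∈ δ.O, X l)) →
      (∀ v, CobordantChart.initEval (fun _ : Fin (m + 1) => 1) (v + u₃) δ.c (δ.f * ∏ l ∈ δ.O, X l) =
        CobordantChart.initEval (fun _ : Fin (m + 1) => 1) v δ.c (δ.f * ∏ l ∈ δ.O, X l)) →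
      ∃ α β γ : k, (α ≠ 0 ∨ β ≠ 0 ∨ γ ≠ 0) ∧ α • u₁ + β • u₂ + γ • u₃ = 0)
    {c' : Fin (m + 1) → k} {i' : Fin (m + 1)} (hci' : c' i' ≠ 0) {A : ℕ} {G : MvPowerSeries (Fin (m + 1 + 1)) k}
    (hfac : subst (CobordantChart.chart (fun _ : Fin (m + 1) => 1) c') (δ.f * ∏ l ∈ δ.O, X l) = X 0 ^ A * G) (hG : ¬ X 0 ∣ G)
    (hhead : (δ.transform (fun j => (X j : MvPowerSeries (Fin (m + 1)) k)) (fun _ => 1) c' i').head = δ.head) :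
    c' = c' a • tangentL a b ψ + c' b • tangentR a b ψ ∧ (c' a ≠ 0 ∨ c' b ≠ 0) := by
  have hf : δ.f ≠ 0 := hadm.2.1.ne_zero
  have hpermX := isBPermissible_point_X δ
  have hconv : ∀ l, (fun _ : Fin (m + 1) => (1 : ℕ)) l = 0 → c' l = 0 := fun _ h => absurd h one_ne_zero
  have hfacX : subst (CobordantChart.chart (fun _ : Fin (m + 1) => 1) c')
      (subst (fun j => (X j : MvPowerSeries (Fin (m + 1)) k)) (δ.f * ∏ l ∈ δ.O, X l)) = X 0 ^ A * G := by
    rw [show subst (fun j => (X j : MvPowerSeries (Fin (m + 1)) k)) (δ.f * ∏ l ∈ δ.O, X l) = δ.f * ∏ l ∈ δ.O, X l from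
      congrFun subst_self _]
    exact hfac
  obtain ⟨hA, -⟩ := Decoration.order_slice_totalO_eq hpermX hconv hf hci' hfacX hG
  subst hA
  have hnear := GraphCurve.le_order_slice_of_head_eq hadm hpermX hconv hci' hfacX hG hhead
  -- (N1) with history: `c′` is an invariance vector of `in_o f` vanishing on the old letters
  have hord : δ.f.order = (δ.o : ℕ∞) := GraphCurve.order_f_eq_o hadm
  obtain ⟨hinvf, hzero⟩ := TOT2Near.near_old δ.f hord δ.O c' i' hci' (by exact hfac) (by exact hnear)
  have hinvg : ∀ v, CobordantChart.initEval (fun _ : Fin (m + 1) => 1) (v + c') δ.c (δ.f * ∏ l ∈ δ.O, X l) =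
      CobordantChart.initEval (fun _ : Fin (m + 1) => 1) v δ.c (δ.f * ∏ l ∈ δ.O, X l) :=
    (TOT2Near.inv_mul_prod_X_iff hord δ.O c').mpr ⟨fun v => by simpa using hinvf 1 v, hzero⟩
  have hgc : (δ.f * ∏ l ∈ δ.O, X l).order = (δ.c : ℕ∞) := Decoration.order_totalO hadm
  have hc' : c' = c' a • tangentL a b ψ + c' b • tangentR a b ψ := eq_combo_tangent_of_inv hab hψ hgc hperm htwo hinvg
  refine ⟨hc', ?_⟩
  by_contra hne
  push Not at hne
  have hz : c' = 0 := by rw [hc', hne.1, hne.2, zero_smul, zero_smul, add_zero]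
  exact hci' (by rw [hz]; rfl)

/-- The coordinates of an answer in the tangent plane: `c′_j = c′_a · ∂₁ψ_j(0) + c′_b · ∂₂ψ_j(0)` for `j ∉ {a,b}`. -/
theorem answer_apply_of_eq_combo_tangent {a b : Fin (m + 1)} {ψ : Fin (m + 1) → MvPowerSeries (Fin 2) k} {c' : Fin (m + 1) → k}
    (hc' : c' = c' a • tangentL a b ψ + c' b • tangentR a b ψ) {j : Fin (m + 1)} (hj : ¬ (j = a ∨ j = b)) :
    c' j = c' a * coeff (Finsupp.single 0 1) (ψ j) + c' b * coeff (Finsupp.single 1 1) (ψ j) := by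
  conv_lhs => rw [hc']
  rw [Pi.add_apply, Pi.smul_apply, Pi.smul_apply, tangentL_of_ne ψ hj, tangentR_of_ne ψ hj, smul_eq_mul, smul_eq_mul]

/-- A letter off the base that PASSES THROUGH an answer in the tangent plane (`c′_l = 0`) has a trace `ψ_l` whose linear part vanishes at the
direction `(c′_a, c′_b)`: `c′_a · ∂₁ψ_l(0) + c′_b · ∂₂ψ_l(0) = 0`. -/
theorem linear_coeffs_eq_zero_of_answer_eq_zero {a b : Fin (m + 1)} {ψ : Fin (m + 1) → MvPowerSeries (Fin 2) k} {c' : Fin (m + 1) → k}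
    (hc' : c' = c' a • tangentL a b ψ + c' b • tangentR a b ψ) {l : Fin (m + 1)} (hl : ¬ (l = a ∨ l = b)) (h0 : c' l = 0) :
    c' a * coeff (Finsupp.single 0 1) (ψ l) + c' b * coeff (Finsupp.single 1 1) (ψ l) = 0 := by
  rw [← answer_apply_of_eq_combo_tangent hc' hl, h0]

end GraphSurf

end TameFourTupleDrop

end Summit.ResolutionOfSingularities.ResolutionOfSingularities.Theorems

end
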